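import Summits.Ventures.PercRepro.RankLevelSetContractMono
import Summits.Ventures.PercRepro.RankLevelSetFrameQ

/-!
# PercRepro — C-037 AT A COLOOP is a theorem modulo C-025 on the deletion (night-1, gen 7; RULING (um)(25)(d))

For a coloop `e` of a matroid of rank `p + 1`, `M ／ {e} = M ＼ {e} =: M′`, and the contraction monotonicity of the
slack at `(p + 1, q + 1)` follows from C-025 for `M′` at `(p, q + 1)` alone:
  `σ_M(p+1,q+1) − σ_{M′}(p,q+1) = #Y_{M′}(p,q+1) + W_p(M′) + W_{q+1}(M′) − (Φ(p+1,q+1) − Φ(p,q+1))·#U_{M′}(p,q+1)`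
(the cell's coloop identities `topCount_eq_of_isColoop_of_eRank`, `midCount_eq_of_isColoop_q`), and the right side is
`≥ (2Φ(p,q+1) + 2 − Φ(p+1,q+1))·#U_{M′} ≥ 0` by the two injections `#U ≤ W_p`, `#U ≤ W_{q+1}` and
`Φ(p+1,q+1) ≤ 2Φ(p,q+1) + 2` (`phiK_succ_le_two_mul_add_two`).  So (MC∃) is only ever needed at a coloop-free
matroid (the CORE form of RankLevelSetContractMonoCore already reduces to cores; this is the direct statement).
Axioms: standard.
-/

open scoped Matroid

namespace PercRepro

namespace Matroid

open Set

variable {α : Type} {M : _root_.Matroid α} [M.Finite]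

/-- **C-037 at a coloop, modulo C-025 on the deletion**: `e` a coloop, `r(M) = p + 1`, `q + 1 < p`, and
`M ＼ {e}` satisfying C-025 at `(p, q + 1)`; then `σ_{M ／ {e}}(p, q + 1) ≤ σ_M(p + 1, q + 1)`. -/
theorem contractMono_of_isColoop {e : α} (he : M.IsColoop e) {p q : ℕ} (hp : q + 1 < p)
    (hR : M.eRank = ((p + 1 : ℕ) : ℕ∞))
    (hIH : phiK p (q + 1) * (topCount (M ＼ {e}) p (q + 1) : ℚ) ≤ (midCount (M ＼ {e}) p (q + 1) : ℚ)) :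
    slack (M ／ {e}) p (q + 1) ≤ slack M (p + 1) (q + 1) := by
  have hcd : M ／ {e} = M ＼ {e} :=
    Matroid.contract_eq_delete_of_subset_coloops (Set.singleton_subset_iff.2 he)
  rw [hcd]
  unfold slack
  have hU : topCount M (p + 1) (q + 1) = topCount (M ＼ {e}) p (q + 1) :=
    topCount_eq_of_isColoop_of_eRank he q hR
  rw [hU, midCount_eq_of_isColoop_q he hp]
  push_cast
  have hΦ := phiK_succ_le_two_mul_add_two p (q + 1) hp
  have htop : (topCount (M ＼ {e}) p (q + 1) : ℚ) ≤ levelCount (M ＼ {e}) p := by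
    exact_mod_cast topCount_le_levelCount_top p (q + 1)
  have hbot : (topCount (M ＼ {e}) p (q + 1) : ℚ) ≤ levelCount (M ＼ {e}) (q + 1) := by
    exact_mod_cast topCount_le_levelCount_bot p (q + 1)
  have hU0 : (0 : ℚ) ≤ topCount (M ＼ {e}) p (q + 1) := by positivity
  nlinarith [hΦ, hIH, htop, hbot, hU0]

/-- The same with the hypothesis in `ThmN.RLS` form, at the levels `(p, q)` of the conclusion. -/
theorem contractMono_of_isColoop' {e : α} (he : M.IsColoop e) {p q : ℕ} (hq : 1 ≤ q) (hpq : q + 2 ≤ p)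
    (hR : M.eRank = (p : ℕ∞)) (hIH : ThmN.RLS (M ＼ {e}) (p - 1) q) :
    slack (M ／ {e}) (p - 1) q ≤ slack M p q := by
  obtain ⟨p', rfl⟩ : ∃ p', p = p' + 1 := ⟨p - 1, by omega⟩
  obtain ⟨q', rfl⟩ : ∃ q', q = q' + 1 := ⟨q - 1, by omega⟩
  rw [Nat.add_sub_cancel]
  rw [ThmN.RLS_iff] at hIH
  exact contractMono_of_isColoop he (by omega) hR hIH

end Matroid

end PercRepro
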